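import Mathlib

/-!
# The Siegel dimension count

Stub `stub_unknownCount` (R6) for the crux `HilbertIntegralOverconvergentIsCongruence`
(line Sketch-ideate-r1-k1): the elementary count of the unknowns in Siegel's lemma for the Hilbert
integral overconvergent engine.  With `u = |k| + 1`, the auxiliary level-one forms
`F_j ∈ M_{b_j}(SL₂(ℤ))`, `j = 0, …, D`, have weights `b_j = 12 u D - j k`, and the unknowns are their
coefficients on the integral unitriangular basis `{E₄^α E₆^β Δ^i : i ∈ J(b_j)}`, where
`J b = {i ≤ b / 12 : b - 12 i ≠ 2}` for even `b` and `J b = ∅` for odd `b`.  The number of unknowns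
`card D = Σ_{j ≤ D} #J(b_j)` satisfies

* `1 ≤ card D` for `D ≥ 1` (the term `j = 0` has the even weight `b₀ = 12 u D` and `0 ∈ J b₀`);
* `card D ≤ (24 u) ^ D` for `D ≥ 1` (`#J b ≤ b / 12 + 1` and `b_j ≤ 13 u D`, so
  `card D ≤ (D + 1) · 2 u D ≤ (24 u) ^ D`);
* quadratic growth: for every `m` some `D ≥ 1` has `2 m D + 1 ≤ card D` (take `D = 12 (m + 1)` and
  keep only the even indices `j = 2 j'`, `j' ≤ 6 (m + 1)`: then `b_j` is even, `b_j ≥ 11 u D`, and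
  `#J b ≥ b / 12` because the filter removes at most the single index `(b - 2) / 12`).
-/

set_option linter.dupNamespace false

namespace Summit.Langlands.Langlands.Theorems.HilbertIntegralOverconvergentIsCongruence

/-- Upper bound for the index sets: `#J b ≤ b / 12 + 1`. -/
theorem unknownCount_card_le (J : ℕ → Finset ℕ)
    (hJ : ∀ b : ℕ, J b = if Even b then
      (Finset.range (b / 12 + 1)).filter (fun i ↦ b - 12 * i ≠ 2) else ∅)
    (b : ℕ) : (J b).card ≤ b / 12 + 1 := by
  rw [hJ]
  split_ifs
  · exact (Finset.card_filter_le _ _).trans (Finset.card_range _).le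
  · simp

/-- Lower bound for the index sets at even weights: `b / 12 ≤ #J b`, because the filter removes at
most the single index `(b - 2) / 12` from `{0, …, b / 12}`. -/
theorem unknownCount_le_card (J : ℕ → Finset ℕ)
    (hJ : ∀ b : ℕ, J b = if Even b then
      (Finset.range (b / 12 + 1)).filter (fun i ↦ b - 12 * i ≠ 2) else ∅)
    (b : ℕ) (hb : Even b) : b / 12 ≤ (J b).card := by
  rw [hJ, if_pos hb]
  calc b / 12 = (Finset.range (b / 12 + 1)).card - 1 := by
        rw [Finset.card_range, Nat.add_sub_cancel]
    _ ≤ ((Finset.range (b / 12 + 1)).erase ((b - 2) / 12)).card :=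
        Finset.pred_card_le_card_erase
    _ ≤ ((Finset.range (b / 12 + 1)).filter (fun i ↦ b - 12 * i ≠ 2)).card := by
        refine Finset.card_le_card (fun i hi ↦ ?_)
        rw [Finset.mem_erase] at hi
        rw [Finset.mem_filter]
        refine ⟨hi.2, fun h ↦ hi.1 ?_⟩
        omega

/-- Integer bounds for the weights `b_j = 12 u D - j k` (`j ≤ D`, `u = |k| + 1`):
`11 u D ≤ b_j ≤ 13 u D`. -/
theorem unknownCount_weight_bounds (k : ℤ) (u D j : ℕ) (hu : u = k.natAbs + 1) (hj : j ≤ D) :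
    (11 * (u * D) : ℤ) ≤ ((12 * u * D : ℕ) : ℤ) - j * k ∧
      ((12 * u * D : ℕ) : ℤ) - j * k ≤ 13 * (u * D) := by
  have hu' : (u : ℤ) = |k| + 1 := by
    rw [hu]
    push_cast
    ring
  have hjk : |(j : ℤ) * k| ≤ D * |k| := by
    rw [abs_mul, Nat.abs_cast]
    exact mul_le_mul_of_nonneg_right (by exact_mod_cast hj) (abs_nonneg k)
  obtain ⟨h1, h2⟩ := abs_le.mp hjk
  have hD : (0 : ℤ) ≤ D := by positivity
  have hDk : (0 : ℤ) ≤ D * |k| := by positivity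
  push_cast
  rw [hu']
  constructor
  · nlinarith
  · nlinarith

/-- Natural-number bounds for the weights `(12 u D - j k).toNat` (`j ≤ D`, `u = |k| + 1`):
`11 u D ≤ b_j ≤ 13 u D`. -/
theorem unknownCount_weight_toNat (k : ℤ) (u D j : ℕ) (hu : u = k.natAbs + 1) (hj : j ≤ D) :
    11 * (u * D) ≤ (((12 * u * D : ℕ) : ℤ) - j * k).toNat ∧
      (((12 * u * D : ℕ) : ℤ) - j * k).toNat ≤ 13 * (u * D) := by
  obtain ⟨h1, h2⟩ := unknownCount_weight_bounds k u D j hu hj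
  have h0 : (0 : ℤ) ≤ ((12 * u * D : ℕ) : ℤ) - j * k := le_trans (by positivity) h1
  constructor
  · rw [Int.le_toNat h0]
    exact_mod_cast h1
  · rw [Int.toNat_le]
    exact_mod_cast h2

/-- For an even index `j = 2 j' ≤ D` the weight `(12 u D - j k).toNat` is even. -/
theorem unknownCount_weight_even (k : ℤ) (u D j' : ℕ) (hu : u = k.natAbs + 1) (hj : 2 * j' ≤ D) :
    Even (((12 * u * D : ℕ) : ℤ) - ((2 * j' : ℕ) : ℤ) * k).toNat := by
  obtain ⟨h1, -⟩ := unknownCount_weight_bounds k u D (2 * j') hu hj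
  have h0 : (0 : ℤ) ≤ ((12 * u * D : ℕ) : ℤ) - ((2 * j' : ℕ) : ℤ) * k :=
    le_trans (by positivity) h1
  rw [← Int.even_coe_nat, Int.toNat_of_nonneg h0]
  exact ⟨6 * u * D - j' * k, by push_cast; ring⟩

/-- The growth estimate `(D + 1) · 2 u D ≤ (24 u) ^ D` for `D ≥ 1`. -/
theorem unknownCount_pow_bound (u D : ℕ) (hD : 1 ≤ D) :
    (D + 1) * (2 * (u * D)) ≤ (24 * u) ^ D := by
  have h2 : D ≤ 2 ^ D := (Nat.lt_two_pow_self).le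
  have hu' : u ≤ u ^ D := Nat.le_self_pow (by omega) u
  have h6 : 6 ≤ 6 ^ D :=
    calc 6 = 6 ^ 1 := (pow_one 6).symm
      _ ≤ 6 ^ D := Nat.pow_le_pow_right (by norm_num) hD
  have h24 : (24 * u) ^ D = 6 ^ D * (2 ^ D * 2 ^ D) * u ^ D := by
    rw [mul_pow, show (24 : ℕ) = 6 * (2 * 2) from rfl, mul_pow, mul_pow]
  calc (D + 1) * (2 * (u * D)) ≤ (2 * D) * (2 * (u * D)) := Nat.mul_le_mul_right _ (by omega)
    _ = 4 * (D * D) * u := by ring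
    _ ≤ 6 * (2 ^ D * 2 ^ D) * u :=
        Nat.mul_le_mul_right u (Nat.mul_le_mul (by norm_num) (Nat.mul_le_mul h2 h2))
    _ ≤ 6 ^ D * (2 ^ D * 2 ^ D) * u ^ D := Nat.mul_le_mul (Nat.mul_le_mul_right _ h6) hu'
    _ = (24 * u) ^ D := h24.symm

/-- **stub R6 — `stub_unknownCount` (the Siegel dimension count).**  With `u = |k| + 1`, weights
`b_j = 12 u D - j k ≥ 11 u D` (`j ≤ D`) and the unitriangular index sets
`J b = {i ≤ b/12 : b - 12 i ≠ 2}` (`b` even; `∅` for odd `b`), the number of unknowns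
`card D = Σ_{j ≤ D} #J(b_j)` satisfies `1 ≤ card D ≤ (24u)^D` for `D ≥ 1` and grows quadratically:
for every `m` some `D ≥ 1` has `2 m D + 1 ≤ card D` (even `j` alone give `≥ (D/2)·(11D/12)`). -/
theorem stub_unknownCount (k : ℤ) (u : ℕ) (hu : u = k.natAbs + 1) (J : ℕ → Finset ℕ)
    (hJ : ∀ b : ℕ, J b = if Even b then
      (Finset.range (b / 12 + 1)).filter (fun i ↦ b - 12 * i ≠ 2) else ∅)
    (card : ℕ → ℕ)
    (hcard : ∀ D, card D = ∑ j ∈ Finset.range (D + 1), (J (((12 * u * D : ℕ) : ℤ) - j * k).toNat).card) :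
    (∀ D, 1 ≤ D → 1 ≤ card D) ∧ (∀ D, 1 ≤ D → (card D : ℝ) ≤ (24 * u : ℝ) ^ D) ∧
      (∀ m : ℕ, ∃ D, 1 ≤ D ∧ 2 * (m * D) + 1 ≤ card D) := by
  have hu1 : 1 ≤ u := by omega
  refine ⟨fun D hD ↦ ?_, fun D hD ↦ ?_, fun m ↦ ?_⟩
  · -- (i) the term `j = 0` alone
    rw [hcard]
    have hmem : 0 ∈ Finset.range (D + 1) := by simp
    refine le_trans ?_ (Finset.single_le_sum (fun i _ ↦ Nat.zero_le _) hmem)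
    rw [Nat.cast_zero, zero_mul, sub_zero, Int.toNat_natCast]
    have heven : Even (12 * u * D) := ⟨6 * u * D, by ring⟩
    have hJb := unknownCount_le_card J hJ _ heven
    have hN : D ≤ u * D := Nat.le_mul_of_pos_left D hu1
    have h12 : 12 * u * D / 12 = u * D := by
      rw [mul_assoc, Nat.mul_div_cancel_left _ (by norm_num)]
    omega
  · -- (ii) every term is at most `2 u D`
    have hnat : card D ≤ (24 * u) ^ D := by
      rw [hcard]
      refine le_trans (Finset.sum_le_card_nsmul _ _ (2 * (u * D)) fun j hj ↦ ?_) ?_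
      · rw [Finset.mem_range] at hj
        have hb := (unknownCount_weight_toNat k u D j hu (by omega)).2
        have hJb := unknownCount_card_le J hJ ((((12 * u * D : ℕ) : ℤ) - j * k).toNat)
        have hN : D ≤ u * D := Nat.le_mul_of_pos_left D hu1
        omega
      · rw [Finset.card_range, smul_eq_mul]
        exact unknownCount_pow_bound u D hD
    exact_mod_cast hnat
  · -- (iii) `D = 12 (m + 1)`, keeping only the even indices `j = 2 j'`, `j' ≤ 6 (m + 1)`
    obtain ⟨D, hD⟩ : ∃ D, D = 12 * (m + 1) := ⟨_, rfl⟩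
    refine ⟨D, by omega, ?_⟩
    rw [hcard]
    have hinj : ∀ x ∈ Finset.range (6 * (m + 1) + 1), ∀ y ∈ Finset.range (6 * (m + 1) + 1),
        2 * x = 2 * y → x = y := fun x _ y _ h ↦ by omega
    have hsub : (Finset.range (6 * (m + 1) + 1)).image (fun j' : ℕ ↦ (2 * j' : ℕ)) ⊆
        Finset.range (D + 1) := by
      intro j hj
      simp only [Finset.mem_image, Finset.mem_range] at hj ⊢
      obtain ⟨j', hj', rfl⟩ := hj
      omega
    calc 2 * (m * D) + 1
        ≤ ∑ j' ∈ Finset.range (6 * (m + 1) + 1),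
            (J (((12 * u * D : ℕ) : ℤ) - ((2 * j' : ℕ) : ℤ) * k).toNat).card := by
          refine le_trans ?_ (Finset.card_nsmul_le_sum _ _ (11 * (m + 1)) fun j' hj' ↦ ?_)
          · rw [Finset.card_range, smul_eq_mul, hD]
            nlinarith
          · rw [Finset.mem_range] at hj'
            have hle : 2 * j' ≤ D := by omega
            have heven := unknownCount_weight_even k u D j' hu hle
            have hb := (unknownCount_weight_toNat k u D (2 * j') hu hle).1
            have hJb := unknownCount_le_card J hJ _ heven
            have hN : D ≤ u * D := Nat.le_mul_of_pos_left D hu1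
            omega
      _ = ∑ j ∈ (Finset.range (6 * (m + 1) + 1)).image (fun j' : ℕ ↦ (2 * j' : ℕ)),
            (J (((12 * u * D : ℕ) : ℤ) - j * k).toNat).card := by
          rw [Finset.sum_image hinj]
      _ ≤ _ := Finset.sum_le_sum_of_subset hsub

end Summit.Langlands.Langlands.Theorems.HilbertIntegralOverconvergentIsCongruence
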